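import Mathlib
import HarnessLib

/-!
# Route NegLimited — door support: the cover-to-correlation transfer, lattice form
(rung F-N1/p3, ROUND-11 engine; cell pnp-ideate)

Door item `NegLimited.NeglimitedEpsLogNegationsR` (stmt-PneNP-19860) read in CORRELATION language
(p3 ROUND-11: "t negations ⇐ (1/2+δ)-hardness of a balanced monotone `f` for poly-size MONOTONE
circuits under an FKG measure" — the shape of Rossman, *Correlation bounds against monotone NC¹*,
CCC 2015, Lemma 1.3 / §7, there phrased with Holley's monotone coupling).

**What is proved here (sorry-free, no named fact, no circuits).**  Let `μ ≥ 0` be a weight on a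
finite distributive lattice `α` satisfying the FKG lattice condition
`μ a · μ b ≤ μ (a ⊓ b) · μ (a ⊔ b)`, let `f : α → Bool` be MONOTONE, and let `gs` be a list of
MONOTONE Boolean functions covering the jumps of `f` (`x ≤ y`, `f x = 0`, `f y = 1` ⇒ some `g ∈ gs`
has `g x = 0`, `g y = 1`).  Then (`massAt_mul_massAt_le_sum_condGap`)

  `μ(f=0) · μ(f=1) ≤ Σ_{g ∈ gs} ( μ(f=0) · μ(f=1 ∧ g=1) − μ(f=1) · μ(f=0 ∧ g=1) )`,

i.e. `1 ≤ Σ_g ( Pr_μ[g=1 | f=1] − Pr_μ[g=1 | f=0] )` when both masses are positive; for BALANCED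
`f` each summand is `μ(f=0)·(μ(g = f) − μ(f=0))` (`condGap_eq_of_balanced`), the correlation
excess.  The circuit-level consequences (with the landed Amano–Maruoka cover
`NegLimitedDoor.amCoverMonPairs_holds`) are in `NegLimitedDoorCorrelationNegations`.

**Proof route (no coupling object).**  The potential `Ψ := #{g ∈ gs : g = 1} + [f = 0]` is
MONOTONE by the jump-cover property (`monotone_coverPotential`), and the two weights
`μ(f=1)·μ·1_{f=0}`, `μ(f=0)·μ·1_{f=1}` have equal mass and satisfy Holley's condition (f monotone,
μ FKG), so Mathlib's `holley` (Combinatorics/SetFamily/FourFunctions, the four functions theorem)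
gives `E₀ Ψ ≤ E₁ Ψ`, which unfolds to the displayed inequality.  [folklore; Holley 1974 /
Liggett 2005 Ch. II Thm 2.9 for the inequality, Rossman CCC 2015 §7 for the use]

HONEST FRAMING: a transfer inequality; it proves no hardness and does not touch the door's open
stub `PlantedCliqueMonotoneAdvantageQuart`; nothing here bears on P vs NP.
-/

set_option linter.dupNamespace false -- `Summit.PneNP.PneNP.…`: summit = sub-problem name (D-0017 single-conjunct layout)

namespace Summit.PneNP.PneNP.Theorems.NegLimitedDoor

open Finset

/-! ### Masses, joint masses, the conditional gap, the cover potential -/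

section Lattice

variable {α : Type*} [Fintype α]

/-- The `μ`-mass of `{f = b}`. -/
def massAt (μ : α → ℝ) (f : α → Bool) (b : Bool) : ℝ := ∑ a, if f a = b then μ a else 0

/-- The `μ`-mass of `{f = b} ∩ {g = 1}`. -/
def jointAt (μ : α → ℝ) (f g : α → Bool) (b : Bool) : ℝ :=
  ∑ a, if f a = b ∧ g a = true then μ a else 0

/-- The `μ`-mass of the agreement set `{g = f}`. -/
def agreeAt (μ : α → ℝ) (f g : α → Bool) : ℝ := ∑ a, if g a = f a then μ a else 0

/-- The cross-normalised conditional gap `μ(f=0)·μ(f=1 ∧ g=1) − μ(f=1)·μ(f=0 ∧ g=1)`; when both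
masses are positive this is `μ(f=0)μ(f=1)·(Pr_μ[g=1 | f=1] − Pr_μ[g=1 | f=0])`. -/
def condGap (μ : α → ℝ) (f g : α → Bool) : ℝ :=
  massAt μ f false * jointAt μ f g true - massAt μ f true * jointAt μ f g false

/-- The cover potential `Ψ(a) = #{g ∈ gs : g a = 1} + [f a = 0]` (real-valued). -/
def coverPotential (f : α → Bool) (gs : List (α → Bool)) (a : α) : ℝ :=
  (gs.map fun g => if g a = true then (1 : ℝ) else 0).sum + if f a = true then 0 else 1

omit [Fintype α] in
/-- A list sum with termwise `φ ≤ χ` and one designated term jumping by `1` grows by at least `1`. -/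
theorem list_sum_add_one_le {β : Type*} (gs : List β) (φ χ : β → ℝ) (hle : ∀ g ∈ gs, φ g ≤ χ g)
    (g₀ : β) (hg₀ : g₀ ∈ gs) (hjump : φ g₀ + 1 ≤ χ g₀) :
    (gs.map φ).sum + 1 ≤ (gs.map χ).sum := by
  induction gs with
  | nil => simp at hg₀
  | cons g gs ih =>
    simp only [List.map_cons, List.sum_cons]
    rcases List.mem_cons.1 hg₀ with rfl | hmem
    · have hrest : (gs.map φ).sum ≤ (gs.map χ).sum :=
        List.sum_le_sum fun x hx => hle x (List.mem_cons_of_mem _ hx)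
      linarith
    · have := ih (fun x hx => hle x (List.mem_cons_of_mem _ hx)) hmem
      have hg : φ g ≤ χ g := hle g List.mem_cons_self
      linarith

omit [Fintype α] in
/-- **The potential is monotone**: each member is monotone, and across a jump of `f` (where `[f=0]`
drops by `1`) some member jumps up by `1`. -/
theorem monotone_coverPotential [Preorder α] {f : α → Bool} {gs : List (α → Bool)}
    (hgs : ∀ g ∈ gs, Monotone g)
    (hcov : ∀ x y, x ≤ y → f x = false → f y = true → ∃ g ∈ gs, g x = false ∧ g y = true) :
    Monotone (coverPotential f gs) := by
  intro x y hxy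
  unfold coverPotential
  have hterm : ∀ g ∈ gs, (if g x = true then (1 : ℝ) else 0) ≤ (if g y = true then 1 else 0) := by
    intro g hg
    have hmono : g x ≤ g y := hgs g hg hxy
    by_cases hx : g x = true
    · have hy : g y = true := by
        rw [hx] at hmono
        exact top_le_iff.mp hmono
      simp [hx, hy]
    · by_cases hy : g y = true
      · simp [hx, hy]
      · simp [hx, hy]
  have hsum : (gs.map fun g => if g x = true then (1 : ℝ) else 0).sum ≤
      (gs.map fun g => if g y = true then (1 : ℝ) else 0).sum := List.sum_le_sum hterm
  by_cases hjump : f x = false ∧ f y = true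
  · obtain ⟨g₀, hg₀, hg₀x, hg₀y⟩ := hcov x y hxy hjump.1 hjump.2
    have hstep := list_sum_add_one_le gs (fun g => if g x = true then (1 : ℝ) else 0)
      (fun g => if g y = true then (1 : ℝ) else 0) hterm g₀ hg₀ (by simp [hg₀x, hg₀y])
    simp only [hjump.1, hjump.2] at hstep ⊢
    simpa using hstep
  · have hind : (if f x = true then (0 : ℝ) else 1) ≤ (if f y = true then 0 else 1) := by
      cases hfx : f x <;> cases hfy : f y <;> simp_all
    exact add_le_add hsum hind

/-- `massAt` is nonnegative for a nonnegative weight. -/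
theorem massAt_nonneg {μ : α → ℝ} (hμ0 : ∀ a, 0 ≤ μ a) (f : α → Bool) (b : Bool) :
    0 ≤ massAt μ f b :=
  sum_nonneg fun a _ => by split_ifs <;> simp [hμ0]

/-- The two masses add up to the total mass. -/
theorem massAt_false_add_massAt_true (μ : α → ℝ) (f : α → Bool) :
    massAt μ f false + massAt μ f true = ∑ a, μ a := by
  unfold massAt
  rw [← sum_add_distrib]
  refine sum_congr rfl fun a _ => ?_
  cases f a <;> simp

/-- The agreement mass splits as `μ(f=1 ∧ g=1) + (μ(f=0) − μ(f=0 ∧ g=1))`. -/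
theorem agreeAt_eq (μ : α → ℝ) (f g : α → Bool) :
    agreeAt μ f g = jointAt μ f g true + (massAt μ f false - jointAt μ f g false) := by
  unfold agreeAt jointAt massAt
  rw [← sum_sub_distrib, ← sum_add_distrib]
  refine sum_congr rfl fun a _ => ?_
  cases f a <;> cases g a <;> simp

/-- The list sum of the conditional gaps, expanded. -/
theorem sum_map_condGap (μ : α → ℝ) (f : α → Bool) (gs : List (α → Bool)) :
    (gs.map (condGap μ f)).sum =
      massAt μ f false * (gs.map fun g => jointAt μ f g true).sum -
        massAt μ f true * (gs.map fun g => jointAt μ f g false).sum := by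
  induction gs with
  | nil => simp
  | cons g gs ih =>
    simp only [List.map_cons, List.sum_cons, ih, condGap]
    ring

/-- Swapping a list sum with a finite sum (bookkeeping). -/
theorem sum_list_sum_map (gs : List (α → Bool)) (F : (α → Bool) → α → ℝ) :
    ∑ a, (gs.map fun g => F g a).sum = (gs.map fun g => ∑ a, F g a).sum := by
  induction gs with
  | nil => simp
  | cons g gs ih => simp only [List.map_cons, List.sum_cons, sum_add_distrib, ih]

omit [Fintype α] in
/-- `(Σ_{g ∈ gs} [g a]) · c = Σ_{g ∈ gs} (if g a then c else 0)` (bookkeeping). -/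
theorem sum_map_boole_mul (gs : List (α → Bool)) (a : α) (c : ℝ) :
    (gs.map fun g => if g a = true then (1 : ℝ) else 0).sum * c =
      (gs.map fun g => if g a = true then c else 0).sum := by
  induction gs with
  | nil => simp
  | cons g gs ih =>
    simp only [List.map_cons, List.sum_cons, add_mul, ih]
    split_ifs <;> ring

/-- **Cover-to-correlation transfer, lattice form.**  For an FKG weight `μ ≥ 0`, a monotone `f`
and a list of monotone functions covering the jumps of `f`:
`μ(f=0)·μ(f=1) ≤ Σ_{g ∈ gs} condGap μ f g`.  Proof: Holley's inequality (Mathlib `holley`) for the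
weights `μ(f=1)·μ·1_{f=0} ≼ μ(f=0)·μ·1_{f=1}` tested against the monotone potential
`coverPotential f gs`. -/
theorem massAt_mul_massAt_le_sum_condGap [DistribLattice α]
    (μ : α → ℝ) (hμ0 : ∀ a, 0 ≤ μ a) (hμ : ∀ a b, μ a * μ b ≤ μ (a ⊓ b) * μ (a ⊔ b))
    (f : α → Bool) (hf : Monotone f) (gs : List (α → Bool)) (hgs : ∀ g ∈ gs, Monotone g)
    (hcov : ∀ x y, x ≤ y → f x = false → f y = true → ∃ g ∈ gs, g x = false ∧ g y = true) :
    massAt μ f false * massAt μ f true ≤ (gs.map (condGap μ f)).sum := by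
  set Z₀ := massAt μ f false with hZ₀def
  set Z₁ := massAt μ f true with hZ₁def
  have hZ₀ : 0 ≤ Z₀ := massAt_nonneg hμ0 f false
  have hZ₁ : 0 ≤ Z₁ := massAt_nonneg hμ0 f true
  -- the two weights and the test function
  set w₀ : α → ℝ := fun a => Z₁ * (if f a = false then μ a else 0) with hw₀def
  set w₁ : α → ℝ := fun a => Z₀ * (if f a = true then μ a else 0) with hw₁def
  set ψ : α → ℝ := coverPotential f gs with hψdef
  have hι : ∀ a b, 0 ≤ (if f a = b then μ a else 0) := fun a b => by
    split_ifs <;> simp [hμ0]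
  have hw₀ : 0 ≤ w₀ := fun a => mul_nonneg hZ₁ (hι a false)
  have hw₁ : 0 ≤ w₁ := fun a => mul_nonneg hZ₀ (hι a true)
  have hψ0 : 0 ≤ ψ := fun a => by
    change (0 : ℝ) ≤ coverPotential f gs a
    unfold coverPotential
    refine add_nonneg (List.sum_nonneg ?_) (by split_ifs <;> norm_num)
    intro t ht
    obtain ⟨g, -, rfl⟩ := List.mem_map.1 ht
    split_ifs <;> norm_num
  have hψ : Monotone ψ := monotone_coverPotential hgs hcov
  have hmass : ∑ a, w₀ a = ∑ a, w₁ a := by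
    simp only [hw₀def, hw₁def, ← mul_sum]
    change Z₁ * massAt μ f false = Z₀ * massAt μ f true
    rw [← hZ₀def, ← hZ₁def, mul_comm]
  have hholley : ∀ a b, w₀ a * w₁ b ≤ w₀ (a ⊓ b) * w₁ (a ⊔ b) := by
    intro a b
    by_cases ha : f a = false
    · by_cases hb : f b = true
      · have hab : f (a ⊓ b) = false := by
          have h := hf (inf_le_left : a ⊓ b ≤ a)
          rw [ha] at h
          exact le_bot_iff.mp h
        have hab' : f (a ⊔ b) = true := by
          have h := hf (le_sup_right : b ≤ a ⊔ b)
          rw [hb] at h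
          exact top_le_iff.mp h
        have e1 : w₀ a = Z₁ * μ a := by simp [hw₀def, ha]
        have e2 : w₁ b = Z₀ * μ b := by simp [hw₁def, hb]
        have e3 : w₀ (a ⊓ b) = Z₁ * μ (a ⊓ b) := by simp [hw₀def, hab]
        have e4 : w₁ (a ⊔ b) = Z₀ * μ (a ⊔ b) := by simp [hw₁def, hab']
        rw [e1, e2, e3, e4]
        calc Z₁ * μ a * (Z₀ * μ b) = (Z₁ * Z₀) * (μ a * μ b) := by ring
          _ ≤ (Z₁ * Z₀) * (μ (a ⊓ b) * μ (a ⊔ b)) :=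
              mul_le_mul_of_nonneg_left (hμ a b) (mul_nonneg hZ₁ hZ₀)
          _ = Z₁ * μ (a ⊓ b) * (Z₀ * μ (a ⊔ b)) := by ring
      · have e1 : w₁ b = 0 := by simp only [hw₁def, hb]; simp
        rw [e1, mul_zero]
        exact mul_nonneg (hw₀ _) (hw₁ _)
    · have e1 : w₀ a = 0 := by simp only [hw₀def, ha]; simp
      rw [e1, zero_mul]
      exact mul_nonneg (hw₀ _) (hw₁ _)
  have H := holley w₀ w₁ ψ hψ0 hw₀ hw₁ hψ hmass hholley
  -- unfold both sides of Holley's conclusion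
  have hL : ∀ a, ψ a * w₀ a =
      Z₁ * ((gs.map fun g => if f a = false ∧ g a = true then μ a else 0).sum +
        (if f a = false then μ a else 0)) := by
    intro a
    change coverPotential f gs a * w₀ a = _
    cases hfa : f a
    · have hw : w₀ a = Z₁ * μ a := by simp [hw₀def, hfa]
      rw [hw]
      simp only [coverPotential, hfa, Bool.false_eq_true, if_false, true_and, if_true]
      rw [← sum_map_boole_mul gs a (μ a)]
      ring
    · have hw : w₀ a = 0 := by simp [hw₀def, hfa]
      rw [hw]
      simp
  have hR : ∀ a, ψ a * w₁ a =
      Z₀ * (gs.map fun g => if f a = true ∧ g a = true then μ a else 0).sum := by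
    intro a
    change coverPotential f gs a * w₁ a = _
    cases hfa : f a
    · have hw : w₁ a = 0 := by simp [hw₁def, hfa]
      rw [hw]
      simp
    · have hw : w₁ a = Z₀ * μ a := by simp [hw₁def, hfa]
      rw [hw]
      simp only [coverPotential, hfa, if_true, true_and, add_zero]
      rw [← sum_map_boole_mul gs a (μ a)]
      ring
  have hLsum : ∑ a, ψ a * w₀ a = Z₁ * ((gs.map fun g => jointAt μ f g false).sum + Z₀) := by
    simp only [hL, ← mul_sum, sum_add_distrib, sum_list_sum_map]
    rfl
  have hRsum : ∑ a, ψ a * w₁ a = Z₀ * (gs.map fun g => jointAt μ f g true).sum := by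
    simp only [hR, ← mul_sum, sum_list_sum_map]
    rfl
  rw [hLsum, hRsum] at H
  rw [sum_map_condGap, ← hZ₀def, ← hZ₁def]
  nlinarith [H]

/-- For BALANCED `f` (`μ(f=0) = μ(f=1)`), the conditional gap is the correlation excess:
`condGap μ f g = μ(f=0) · (μ(g = f) − μ(f=0))`. -/
theorem condGap_eq_of_balanced (μ : α → ℝ) (f g : α → Bool)
    (hbal : massAt μ f false = massAt μ f true) :
    condGap μ f g = massAt μ f false * (agreeAt μ f g - massAt μ f false) := by
  rw [condGap, agreeAt_eq, ← hbal]
  ring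

end Lattice

end Summit.PneNP.PneNP.Theorems.NegLimitedDoor
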